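import Literature.AnabelianGeometry.SemiGraphs.MetabelianLeafStarEscapeNotVerticial
import HarnessLib

/-!
# The linear character systems of `𝒢⋆(p)` modulo `p^e` and the depth certificate for the elements of the
# escaping `⟨c⟩‾` («C₀-ISOLATED@RAYLESS-STAR», file F1)

Mochizuki, *Semi-graphs of anabelioids*, Publ. RIMS **42** (2006), §3, Prop. 3.6 (ii) p. 38 (the tempered
fundamental group and its decomposition homomorphisms), Thm. 3.7 (iii)/(iv) pp. 40–41, Remark 2.2.1 p. 24
(branch stabilisers) [cite: MochizukiSemiAnbd2006, Thm 3.7(iv) p.41].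

PROOF-ONLY file (no definition, no named fact; abc-iut cell, layer L3, row «C₀-ISOLATED@RAYLESS-STAR», seat
abc-iut-L3-t8 gen 8; in-lineage sequel to gen 6/7's
`MetabelianLeafStarCharacters` / `…EscapeNotVerticial` / `…EscapeSelfMaximal`).  At the canonical chart of the
rayless star `𝒢⋆(p) = metabelianLeafStar p` with its escaping element `c` (`exists_escapeLimit`,
`C₀ := ⟨c⟩‾ ≅ ℤ_p` the exotic maximal compact subgroup):

* `exists_linCharacter` — the torsor character of the LINEAR character system modulo `p^e` with coefficients
  `(c₁, c₂)`: at the centre `g ↦ c₁ u + c₂ v` (`ab(g) = (u, v)`, `FreeProPRankTwo.linChar`), at the leaf `m` the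
  character `(c₁ + c₂ p^m)·log` (`Iw.logChar`), on the edge `m` the character `t ↦ (c₁ + c₂ p^m) t` — a compatible
  system glued by gen 6's `exists_character_D` (gen 6's `Φ^{(n)}` is `(c₁, c₂) = (−pⁿ, 1)` modulo `p^{n+1}`; here
  every modulus is allowed); it kills a level kernel `ker ρ_{j₁}` and has `Φ(c) = c₁` (`linCharacter_escape`).
* DEPTH OF AN ELEMENT OF `C₀`: every `d ∈ ⟨c⟩‾` has, at each level `j`, the components of a power `c^t`
  (`exists_zpow_proj_eq_of_mem_topologicalClosure`), so `Φ(d) = Φ(c)^t` for every torsor character factoring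
  through that level; a non-trivial `d` is SEEN by the `a`-character `(c₁, c₂) = (1, 0)` modulo some `p^e`
  (`exists_aCharacter_ne_one`: otherwise `p^e ∣ t` for every `e`, and `ρ_m(c)` is killed by `p^{N_m}`).
* **`exists_level_forall_edgeMap_ne`** — the certificate consumed by the isolation theorem: for `d ∈ ⟨c⟩‾ ∖ 1`
  and every base edge `n` there is a level `M₀` such that at every level `M ≥ M₀` the element `d` fixes NO tree
  edge of `𝒢_{∞,M}` over `n` (gen 6's `edgeMap_edgeOf_ne_of_ne_one` with the twisted character `(−pⁿ, 1)`
  modulo `p^{n+e}`, which kills the branch images `⟨a·b^{pⁿ}⟩‾` and sees `d`).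

Honest framing: OUR typed tempered group of OUR countable carrier; print's Thm 3.7 at finite `𝔾` untouched; no
side taken on [IUTchIII] Cor. 3.12; typed ≠ proved.
-/

noncomputable section

open CategoryTheory Topology Multiplicative

namespace Literature.AnabelianGeometry.SemiGraphs

open IwahoriWitness

namespace ProfiniteSemiGraph

/-! ### The torsor character of the linear system -/

variable {p : ℕ} [hp : Fact p.Prime] {h36 : (metabelianLeafStar p).Prop36Hypotheses}
  (P₀ : ((metabelianLeafStar p).galoisLevelData h36).PointSeq h36.isCountable (leafStarCentre p))

/-- **The torsor character `Φ` of the linear system `(e; c₁, c₂)`**: a homomorphism on `π₁^temp(𝒢⋆(p))`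
killing a level kernel and restricting along every decomposition homomorphism at the centre to the linear
character `g ↦ c₁ u + c₂ v` (`ab(g) = (u, v)`); it is glued (gen 6's `exists_character_D`) from that character at the
centre, `(c₁ + c₂ p^m)·log` at the leaf `m` and `t ↦ (c₁ + c₂ p^m) t` on the edge `m`, a compatible system.
[cite: MochizukiSemiAnbd2006, Prop 3.6(ii) p.38] -/
theorem exists_linCharacter (h36 : (metabelianLeafStar p).Prop36Hypotheses) (e : ℕ) (c₁ c₂ : ZMod (p ^ e)) :
    ∃ (Φ : ((metabelianLeafStar p).galoisLevelData h36).temperedPi h36.isCountable →* Multiplicative (ZMod (p ^ e)))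
      (j₁ : ℕ),
      (∀ (Q : ((metabelianLeafStar p).galoisLevelData h36).PointSeq h36.isCountable (leafStarCentre p))
        (g : FreeProPRankTwo.Grp p), Φ (Q.decompHom g) = FreeProPRankTwo.linChar p e c₁ c₂ g) ∧
      ∀ j, j₁ ≤ j → ∀ g, ((metabelianLeafStar p).galoisLevelData h36).proj h36.isCountable j g = 1 → Φ g = 1 := by
  haveI : NeZero p := ⟨hp.out.ne_zero⟩
  -- the edge characters `t ↦ (c₁ + c₂ p^m) t` (the leaf character through the torus)
  let χEdge : ∀ m : ℕ, Multiplicative ℤ_[p] →ₜ* Multiplicative (ZMod (p ^ e)) := fun m =>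
    (Iw.logChar m e (c₁ + c₂ * (p : ZMod (p ^ e)) ^ m)).comp (Iw.lowHom m)
  have hχEdge : ∀ (m : ℕ) (t : Multiplicative ℤ_[p]),
      χEdge m t = ofAdd ((c₁ + c₂ * (p : ZMod (p ^ e)) ^ m) * PadicInt.toZModPow e t.toAdd) := fun m t => by
    change Iw.logChar m e _ (Iw.lowHom m t) = _
    rw [Iw.logChar_lowHom]
  -- the vertex characters: linear at the centre, logarithmic at the leaves
  let χV : ∀ v : (metabelianLeafStar p).graph.Vertex,
      (metabelianLeafStar p).Gv v →ₜ* Multiplicative (ZMod (p ^ e)) := fun v =>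
    match v with
    | none => FreeProPRankTwo.linChar p e c₁ c₂
    | some m => Iw.logChar m e (c₁ + c₂ * (p : ZMod (p ^ e)) ^ m)
  let χE : ∀ x : (metabelianLeafStar p).graph.Edge,
      (metabelianLeafStar p).Ge x →ₜ* Multiplicative (ZMod (p ^ e)) := fun m => χEdge m
  -- compatibility with the gluings
  have hχ : ∀ (b : (metabelianLeafStar p).graph.Branch) (v : (metabelianLeafStar p).graph.Vertex)
      (h : (metabelianLeafStar p).graph.abuts b = some v)
      (t : (metabelianLeafStar p).Ge ((metabelianLeafStar p).graph.edgeOf b)),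
      χV v ((metabelianLeafStar p).brHom b v h t) = χE ((metabelianLeafStar p).graph.edgeOf b) t := by
    rintro ⟨m, c⟩ v h t
    have hv : SemiGraph.leafStarVertexOf (m, c) = v := Option.some.inj h
    subst hv
    cases c
    · change Iw.logChar m e _ (Iw.lowHom m t) = χEdge m t
      rw [Iw.logChar_lowHom, hχEdge]
    · change FreeProPRankTwo.linChar p e c₁ c₂ (FreeProPRankTwo.θα p m t) = χEdge m t
      rw [FreeProPRankTwo.linChar_θα, hχEdge]
  obtain ⟨Φ, hΦP, -, j₁, hj₁⟩ := exists_character_D h36 χV χE hχ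
  exact ⟨Φ, j₁, fun Q g => hΦP (leafStarCentre p) Q g, fun j hj g hg => hj₁ g (proj_eq_one_of_le hj g hg)⟩

/-- A character killing `ker ρ_{j₁}` reads an element through its level-`j` components, `j ≥ j₁`: if
`ρ_j(d) = ρ_j(c^t)` then `Φ(d) = Φ(c)^t`. [cite: MochizukiSemiAnbd2006, Prop 3.6(ii) p.38] -/
theorem character_eq_zpow_of_proj_eq {A : Type*} [CommGroup A]
    (Φ : ((metabelianLeafStar p).galoisLevelData h36).temperedPi h36.isCountable →* A) {j₁ j : ℕ} (hj : j₁ ≤ j)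
    (hker : ∀ j, j₁ ≤ j → ∀ g, ((metabelianLeafStar p).galoisLevelData h36).proj h36.isCountable j g = 1 → Φ g = 1)
    {c d : ((metabelianLeafStar p).galoisLevelData h36).temperedPi h36.isCountable} {t : ℤ}
    (ht : ((metabelianLeafStar p).galoisLevelData h36).proj h36.isCountable j d =
      ((metabelianLeafStar p).galoisLevelData h36).proj h36.isCountable j (c ^ t)) :
    Φ d = Φ c ^ t := by
  have h1 : Φ (d * (c ^ t)⁻¹) = 1 := hker j hj _ (by rw [map_mul, map_inv, ht, mul_inv_cancel])
  rw [map_mul, map_inv, mul_inv_eq_one] at h1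
  rw [h1, map_zpow]

/-- **`Φ(c) = c₁`** for the escaping element `c` (read at the level `j₁` through `c_{N j₁} = h·ψ₀(a)·h⁻¹`).
[cite: MochizukiSemiAnbd2006, Thm 3.7(iv) p.41] -/
theorem linCharacter_escape {e : ℕ} {c₁ c₂ : ZMod (p ^ e)}
    (Φ : ((metabelianLeafStar p).galoisLevelData h36).temperedPi h36.isCountable →* Multiplicative (ZMod (p ^ e)))
    (j₁ : ℕ)
    (hΦP : ∀ (Q : ((metabelianLeafStar p).galoisLevelData h36).PointSeq h36.isCountable (leafStarCentre p))
      (g : FreeProPRankTwo.Grp p), Φ (Q.decompHom g) = FreeProPRankTwo.linChar p e c₁ c₂ g)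
    (hker : ∀ j, j₁ ≤ j → ∀ g, ((metabelianLeafStar p).galoisLevelData h36).proj h36.isCountable j g = 1 → Φ g = 1)
    (c : ((metabelianLeafStar p).galoisLevelData h36).temperedPi h36.isCountable) (N : ℕ → ℕ)
    (hcN : ∀ j k, N j ≤ k → ((metabelianLeafStar p).galoisLevelData h36).proj h36.isCountable j c =
      ((metabelianLeafStar p).galoisLevelData h36).proj h36.isCountable j (escC P₀ k)) :
    Φ c = ofAdd c₁ := by
  have hread : Φ c = Φ (psi0 P₀ (FreeProPRankTwo.a p)) := by
    have h1 : Φ (c * (escC P₀ (N j₁))⁻¹) = 1 :=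
      hker j₁ le_rfl _ (by rw [map_mul, map_inv, hcN j₁ (N j₁) le_rfl, mul_inv_cancel])
    rw [map_mul, map_inv, mul_inv_eq_one] at h1
    rw [h1, escC, map_mul, map_mul, map_inv, mul_inv_cancel_comm]
    rfl
  rw [hread, show Φ (psi0 P₀ (FreeProPRankTwo.a p)) = FreeProPRankTwo.linChar p e c₁ c₂ (FreeProPRankTwo.a p)
    from hΦP P₀ _, FreeProPRankTwo.linChar_a]

/-- `Φ` on the conjugates of the branch image of the edge `n` at the centre: `(c₁ + c₂ pⁿ)·k`.
[cite: MochizukiSemiAnbd2006, Rmk 2.2.1 p.24] -/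
theorem linCharacter_psi0_conj_θα {e : ℕ} {c₁ c₂ : ZMod (p ^ e)}
    (Φ : ((metabelianLeafStar p).galoisLevelData h36).temperedPi h36.isCountable →* Multiplicative (ZMod (p ^ e)))
    (hΦP : ∀ (Q : ((metabelianLeafStar p).galoisLevelData h36).PointSeq h36.isCountable (leafStarCentre p))
      (g : FreeProPRankTwo.Grp p), Φ (Q.decompHom g) = FreeProPRankTwo.linChar p e c₁ c₂ g)
    (n : ℕ) (f : FreeProPRankTwo.Grp p) (k : Multiplicative ℤ_[p]) :
    Φ (psi0 P₀ (f * FreeProPRankTwo.θα p n k * f⁻¹)) =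
      ofAdd ((c₁ + c₂ * (p : ZMod (p ^ e)) ^ n) * PadicInt.toZModPow e k.toAdd) := by
  rw [show Φ (psi0 P₀ (f * FreeProPRankTwo.θα p n k * f⁻¹)) =
      FreeProPRankTwo.linChar p e c₁ c₂ (f * FreeProPRankTwo.θα p n k * f⁻¹) from hΦP P₀ _, map_mul, map_mul, map_inv,
    FreeProPRankTwo.linChar_θα, mul_inv_cancel_comm]

/-! ### The elements of `⟨c⟩‾`: level components of powers, depth -/

/-- **An element of `⟨c⟩‾` has, at each level, the components of a power of `c`** (the level kernel is open).
[cite: MochizukiSemiAnbd2006, Prop 3.6(i) p.38] -/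
theorem exists_zpow_proj_eq_of_mem_topologicalClosure
    (c d : ((metabelianLeafStar p).galoisLevelData h36).temperedPi h36.isCountable)
    (hd : d ∈ (Subgroup.zpowers c).topologicalClosure) (j : ℕ) :
    ∃ t : ℤ, ((metabelianLeafStar p).galoisLevelData h36).proj h36.isCountable j d =
      ((metabelianLeafStar p).galoisLevelData h36).proj h36.isCountable j (c ^ t) := by
  set π := ((metabelianLeafStar p).galoisLevelData h36).proj h36.isCountable j with hπ
  have hU : IsOpen {x : ((metabelianLeafStar p).galoisLevelData h36).temperedPi h36.isCountable | π x = π d} :=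
    (isOpen_discrete {π d}).preimage (((metabelianLeafStar p).galoisLevelData h36).continuous_proj h36.isCountable j)
  have hmem : d ∈ closure ((Subgroup.zpowers c : Subgroup _) :
      Set (((metabelianLeafStar p).galoisLevelData h36).temperedPi h36.isCountable)) := hd
  obtain ⟨x, hxU, hxS⟩ := mem_closure_iff.mp hmem _ hU rfl
  obtain ⟨t, rfl⟩ := Subgroup.mem_zpowers_iff.mp hxS
  exact ⟨t, hxU.symm⟩

/-- The level-`m` component of the escaping element is killed by `p^{N_m}` (a conjugate of `σ_m(a)`).
[cite: MochizukiSemiAnbd2006, Thm 3.7(iii) p.41] -/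
theorem proj_escape_pow_lvl_eq_one (c : ((metabelianLeafStar p).galoisLevelData h36).temperedPi h36.isCountable)
    (N : ℕ → ℕ)
    (hcN : ∀ j k, N j ≤ k → ((metabelianLeafStar p).galoisLevelData h36).proj h36.isCountable j c =
      ((metabelianLeafStar p).galoisLevelData h36).proj h36.isCountable j (escC P₀ k)) (m : ℕ) :
    ((metabelianLeafStar p).galoisLevelData h36).proj h36.isCountable m c ^ p ^ lvl h36 m = 1 := by
  have hy : ((metabelianLeafStar p).galoisLevelData h36).proj h36.isCountable m (escY P₀ ^ p ^ lvl h36 m) = 1 := by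
    change ((metabelianLeafStar p).galoisLevelData h36).proj h36.isCountable m
      (psi0 P₀ (FreeProPRankTwo.a p) ^ p ^ lvl h36 m) = 1
    rw [← map_pow, proj_psi0]
    exact gal_P₀_pow P₀ _ m _ le_rfl
  rw [hcN m (N m) le_rfl, ← map_pow, escC, conj_pow, map_mul, map_mul, hy, mul_one, map_inv, mul_inv_cancel]

/-- **A non-trivial element of `⟨c⟩‾` is seen by some `a`-character**: there is a modulus `p^e` such that the
torsor character of the linear system `(e; 1, 0)` (value `1` on `c`) does not kill `d`.  (Otherwise `p^e ∣ t`
for the exponent `t` of `d` at every deep level, for every `e`; with `e := N_m` this kills `ρ_m(d)`.)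
[cite: MochizukiSemiAnbd2006, Thm 3.7(iv) p.41] -/
theorem exists_aCharacter_ne_one (c : ((metabelianLeafStar p).galoisLevelData h36).temperedPi h36.isCountable)
    (N : ℕ → ℕ)
    (hcN : ∀ j k, N j ≤ k → ((metabelianLeafStar p).galoisLevelData h36).proj h36.isCountable j c =
      ((metabelianLeafStar p).galoisLevelData h36).proj h36.isCountable j (escC P₀ k))
    (d : ((metabelianLeafStar p).galoisLevelData h36).temperedPi h36.isCountable)
    (hd : d ∈ (Subgroup.zpowers c).topologicalClosure) (hd1 : d ≠ 1) :
    ∃ (e : ℕ)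
      (Φ : ((metabelianLeafStar p).galoisLevelData h36).temperedPi h36.isCountable →* Multiplicative (ZMod (p ^ e)))
      (j₁ : ℕ),
      (∀ (Q : ((metabelianLeafStar p).galoisLevelData h36).PointSeq h36.isCountable (leafStarCentre p))
        (g : FreeProPRankTwo.Grp p), Φ (Q.decompHom g) = FreeProPRankTwo.linChar p e 1 0 g) ∧
      (∀ j, j₁ ≤ j → ∀ g, ((metabelianLeafStar p).galoisLevelData h36).proj h36.isCountable j g = 1 → Φ g = 1) ∧
      Φ c = ofAdd 1 ∧ Φ d ≠ 1 := by
  haveI : NeZero p := ⟨hp.out.ne_zero⟩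
  by_contra hcon
  push Not at hcon
  apply hd1
  refine ((metabelianLeafStar p).galoisLevelData h36).pi_ext h36.isCountable fun m => ?_
  rw [map_one]
  obtain ⟨Φ, j₁, hΦP, hker⟩ := exists_linCharacter h36 (lvl h36 m) 1 0
  have hΦc : Φ c = ofAdd 1 := linCharacter_escape P₀ Φ j₁ hΦP hker c N hcN
  have hΦd : Φ d = 1 := hcon (lvl h36 m) Φ j₁ hΦP hker hΦc
  obtain ⟨t, ht⟩ := exists_zpow_proj_eq_of_mem_topologicalClosure c d hd (max m j₁)
  have h1 : Φ d = Φ c ^ t := character_eq_zpow_of_proj_eq Φ (le_max_right m j₁) hker ht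
  rw [hΦd, hΦc, ← ofAdd_zsmul, zsmul_eq_mul, mul_one] at h1
  have hdvd : ((p ^ lvl h36 m : ℕ) : ℤ) ∣ t :=
    (ZMod.intCast_zmod_eq_zero_iff_dvd t (p ^ lvl h36 m)).mp (ofAdd_eq_one.mp h1.symm)
  obtain ⟨q, hq⟩ := hdvd
  have h2 : ((metabelianLeafStar p).galoisLevelData h36).proj h36.isCountable m d =
      ((metabelianLeafStar p).galoisLevelData h36).proj h36.isCountable m (c ^ t) := by
    rw [← ((metabelianLeafStar p).galoisLevelData h36).mapLE_proj h36.isCountable (le_max_left m j₁) d, ht,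
      ((metabelianLeafStar p).galoisLevelData h36).mapLE_proj]
  rw [h2, map_zpow, hq, zpow_mul, zpow_natCast, proj_escape_pow_lvl_eq_one P₀ c N hcN m, one_zpow]

/-! ### The certificate: deep levels see no `d`-fixed edge over a given base edge -/

/-- Integer arithmetic of the certificate: `p^{n+e} ∣ t·pⁿ ⇒ p^e ∣ t`. [cite: MochizukiSemiAnbd2006, Thm 3.7(iv) p.41] -/
theorem dvd_of_pow_add_dvd_mul_pow {n e : ℕ} {t : ℤ} (h : ((p ^ (n + e) : ℕ) : ℤ) ∣ t * (p : ℤ) ^ n) :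
    ((p ^ e : ℕ) : ℤ) ∣ t := by
  have hpn : ((p : ℤ) ^ n) ≠ 0 := pow_ne_zero _ (by exact_mod_cast hp.out.ne_zero)
  rw [Nat.cast_pow, pow_add, mul_comm t] at h
  rw [Nat.cast_pow]
  exact (mul_dvd_mul_iff_left hpn).mp h

/-- **At deep levels `d ∈ ⟨c⟩‾ ∖ 1` fixes no tree edge over the base edge `n`** (at a centre-type vertex
`(a·P₀).vertex M`, over the branch `(n, true)`): the twisted character `(−pⁿ, 1)` modulo `p^{n+e}` kills
`ker ρ_M` and the conjugates of the branch image `⟨a·b^{pⁿ}⟩‾`, and sees `d` (its exponent `t` at level `M` has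
`p^e ∤ t` by the `a`-character); gen 6's `edgeMap_edgeOf_ne_of_ne_one`. [cite: MochizukiSemiAnbd2006, Thm 3.7(iv) p.41] -/
theorem exists_level_forall_edgeMap_ne (c : ((metabelianLeafStar p).galoisLevelData h36).temperedPi h36.isCountable)
    (N : ℕ → ℕ)
    (hcN : ∀ j k, N j ≤ k → ((metabelianLeafStar p).galoisLevelData h36).proj h36.isCountable j c =
      ((metabelianLeafStar p).galoisLevelData h36).proj h36.isCountable j (escC P₀ k))
    (d : ((metabelianLeafStar p).galoisLevelData h36).temperedPi h36.isCountable)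
    (hd : d ∈ (Subgroup.zpowers c).topologicalClosure) (hd1 : d ≠ 1) (n : ℕ) :
    ∃ M₀ : ℕ, ∀ M, M₀ ≤ M →
      ∀ (a : ((metabelianLeafStar p).galoisLevelData h36).temperedPi h36.isCountable)
        (β : (((metabelianLeafStar p).galoisLevelData h36).tree M).Branch),
        (((metabelianLeafStar p).galoisLevelData h36).treeProj M).branchMap β = ((n, true) : ℕ × Bool) →
        (((metabelianLeafStar p).galoisLevelData h36).tree M).abuts β = some ((P₀.smul a).vertex M) →
        (((metabelianLeafStar p).galoisLevelData h36).treeAct h36.isCountable M d).hom.edgeMap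
            ((((metabelianLeafStar p).galoisLevelData h36).tree M).edgeOf β) ≠
          (((metabelianLeafStar p).galoisLevelData h36).tree M).edgeOf β := by
  haveI : NeZero p := ⟨hp.out.ne_zero⟩
  obtain ⟨e, Φa, ja, -, hkera, hΦac, hΦad⟩ := exists_aCharacter_ne_one P₀ c N hcN d hd hd1
  obtain ⟨Φ, j₁, hΦP, hker⟩ := exists_linCharacter h36 (n + e) (-((p : ZMod (p ^ (n + e))) ^ n)) 1
  have hΦc : Φ c = ofAdd (-((p : ZMod (p ^ (n + e))) ^ n)) := linCharacter_escape P₀ Φ j₁ hΦP hker c N hcN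
  refine ⟨max ja j₁, fun M hM a β hβb hβ => ?_⟩
  refine edgeMap_edgeOf_ne_of_ne_one P₀ Φ M n (hker M (le_of_max_le_right hM)) (fun f k => ?_) d ?_ a β hβb hβ
  · rw [linCharacter_psi0_conj_θα P₀ Φ hΦP n f k, one_mul, neg_add_cancel, zero_mul, ofAdd_zero]
  · -- the exponent `t` of `d` at level `M`: `p^e ∤ t` by the `a`-character, so `Φ(d) = −pⁿ t ≠ 0 (mod p^{n+e})`
    obtain ⟨t, ht⟩ := exists_zpow_proj_eq_of_mem_topologicalClosure c d hd M
    have h1 : Φ d = Φ c ^ t := character_eq_zpow_of_proj_eq Φ (le_of_max_le_right hM) hker ht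
    have h2 : Φa d = Φa c ^ t := character_eq_zpow_of_proj_eq Φa (le_of_max_le_left hM) hkera ht
    have hndvd : ¬ ((p ^ e : ℕ) : ℤ) ∣ t := by
      intro hdvd
      apply hΦad
      rw [h2, hΦac, ← ofAdd_zsmul, zsmul_eq_mul, mul_one, (ZMod.intCast_zmod_eq_zero_iff_dvd t (p ^ e)).mpr hdvd,
        ofAdd_zero]
    intro hΦd
    rw [h1, hΦc, ← ofAdd_zsmul, zsmul_eq_mul, ofAdd_eq_one, mul_neg, neg_eq_zero] at hΦd
    apply hndvd
    refine dvd_of_pow_add_dvd_mul_pow (n := n) ?_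
    rw [← ZMod.intCast_zmod_eq_zero_iff_dvd]
    push_cast
    exact hΦd

end ProfiniteSemiGraph

end Literature.AnabelianGeometry.SemiGraphs

end
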